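import Mathlib.Algebra.Quaternion
import Mathlib.Algebra.Central.Defs
import Mathlib.RingTheory.SimpleRing.Basic
import Mathlib.RingTheory.TensorProduct.Basic
import Mathlib.RingTheory.TensorProduct.Maps
import Mathlib.RingTheory.TensorProduct.Finite
import Mathlib.RingTheory.Trace.Defs
import Mathlib.RingTheory.Norm.Defs
import Mathlib.Topology.Algebra.Algebra
import Mathlib.Topology.Algebra.Module.ModuleTopology
import Mathlib.NumberTheory.NumberField.AdeleRing
import Mathlib.NumberTheory.NumberField.InfinitePlace.TotallyRealComplex
import Mathlib.NumberTheory.NumberField.Completion.InfinitePlace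
import Literature.NumberTheory.Automorphic.AdelicGroupData
import HarnessLib

-- provenance: harness21/H21/H21/Prelude/AutomorphicAxiomatic/QuaternionAlgebraAdelic.lean @ 2c4ac8d (interim HEAD d8f2665); M5 mechanical rewrite
/-!
# Quaternion algebras over number fields and their adelic unit groups

Trunk `AutomorphicAxiomatic` (G19), item C8 `QuaternionAlgebraAdelic`; namespace
`Literature.Automorphic`.

Contents:

* `IsQuaternionAlgebra K D`: `D` is a central simple `K`-algebra of dimension `4`
  (field-style `Prop` class, no `extends`, review F5); the reduced trace, standard involution
  and reduced norm `reducedTrace`, `standardInvolution`, `reducedNorm` written in terms of the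
  left-multiplication trace `leftMulTrace = LinearMap.trace ∘ Algebra.lmul` (Mathlib's
  `Algebra.trace` is only declared for commutative algebras, so it cannot be used for `D`);
  honest for quaternion algebras in characteristic `≠ 2`, junk otherwise — documented; `QuaternionAlgebra.isQuaternionAlgebra` for Mathlib's `ℍ[K,a,b]`.
* `ScalarExtension K R D := R ⊗[K] D` for a topological commutative `K`-algebra `R`, with its
  `R`-algebra structure (Mathlib `Algebra.TensorProduct.leftAlgebra`) and the `R`-module topology
  (Mathlib `moduleTopology`, `IsModuleTopology.isTopologicalRing`), so that its unit group is a
  topological group. Specialisations: `adelicUnits K D = (D ⊗ 𝔸_K)ˣ`,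
  `finiteAdelicUnits K D = (D ⊗ 𝔸_K^∞)ˣ` (FLT project's `Dfx`), `completionUnits D v = (D ⊗ K_v)ˣ`.
* Ramification: `IsSplitAt D v`, `IsSplitAtInfinite D w`, `ramifiedPlaces`, `ramifiedInfinitePlaces`,
  `IsTotallyDefinite`, with the classical finiteness/parity/classification theorems (`sorry`).
* The global datum `AdelicGroupData.units K D` of the algebraic group `D^×` (moved here from C9,
  review F10), with `center' = A_G = ℝ_{>0}` (`posRealCentral`, outline D10) and honest proofs of
  centrality and of continuity of `G(𝔸_K) → G(K_v)`; Fujisaki's compactness theorem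
  `AdelicGroupData.compactSpace_automorphicQuotient_units` (`sorry`).

## Mathlib searches

Mathlib has `Algebra.IsCentral`, `IsSimpleRing`, `QuaternionAlgebra` (`ℍ[K,a,b]`, with
`QuaternionAlgebra.finrank_eq_four`), `Algebra.trace`, `Algebra.norm`, tensor products of algebras,
`moduleTopology`, adeles and completions; it has no notion of quaternion algebra as a *property*
of an abstract algebra, no reduced norm/trace for central simple algebras, and no adelic points of
`D^×` (all checked with `rg`). The design of `IsQuaternionAlgebra` follows Mathlib
`Mathlib/Algebra/Central/Defs.lean` (l. 28–45: a projection to `IsSimpleRing D` cannot be an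
instance because `K` is not determined) and the FLT project (`IsQuaternionAlgebra`, `Dfx`).
`K` is an explicit argument of `ScalarExtension` since it cannot be inferred from `R` and `D`.

## References

* M.-F. Vignéras, *Arithmétique des algèbres de quaternions*, LNM 800 (1980), Ch. I–III.
* K. Buzzard et al., *FLT project*, `FLT/AutomorphicForm/QuaternionAlgebra/Defs.lean` (`Dfx`).
* A. Weil, *Basic Number Theory*, Ch. IX–XI; Fujisaki's lemma: Vignéras III.1–III.2.
-/

noncomputable section

open scoped TensorProduct NNReal Quaternion
open NumberField IsDedekindDomain MeasureTheory

universe u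

namespace Literature.NumberTheory.Automorphic

/-! ### Quaternion algebras as a property -/

section IsQuaternionAlgebra

variable (K : Type*) (D : Type*) [Field K] [Ring D] [Algebra K D]

/-- `IsQuaternionAlgebra K D`: `D` is a **quaternion algebra** over the field `K`, i.e. a central
simple `K`-algebra of dimension `4` (Vignéras, LNM 800, Ch. I §1; FLT project). Field-style class
without `extends` (review F5): the projection `isSimpleRing` cannot be an instance since `K` does
not occur in `IsSimpleRing D` (Mathlib `Algebra/Central/Defs.lean`); use
`IsQuaternionAlgebra.isSimpleRing'` via `haveI`. [folklore] -/
class IsQuaternionAlgebra : Prop where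
  /-- The centre of `D` is `K`. -/
  [isCentral : Algebra.IsCentral K D]
  /-- `D` is a simple ring. -/
  isSimpleRing : IsSimpleRing D
  /-- `dim_K D = 4`. -/
  finrank_eq_four : Module.finrank K D = 4

attribute [instance] IsQuaternionAlgebra.isCentral

/-- A quaternion algebra is a simple ring (Vignéras I §1). `K` is explicit: use as
`haveI := IsQuaternionAlgebra.isSimpleRing' K D`. [folklore] -/
theorem IsQuaternionAlgebra.isSimpleRing' [IsQuaternionAlgebra K D] : IsSimpleRing D :=
  IsQuaternionAlgebra.isSimpleRing K

/-- A quaternion algebra is finite-dimensional over its centre (immediate from `finrank = 4`;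
Vignéras I §1). Both `K` and `D` occur in the conclusion, so this is a legitimate instance. [folklore] -/
instance IsQuaternionAlgebra.finite [IsQuaternionAlgebra K D] : Module.Finite K D :=
  Module.finite_of_finrank_eq_succ (IsQuaternionAlgebra.finrank_eq_four (K := K) (D := D))

/-- Mathlib's quaternion algebra `ℍ[K,a,b]` (`i² = a`, `j² = b`, `ij = -ji`) with `a b ≠ 0` over a
field of characteristic `≠ 2` is a quaternion algebra in the sense of `IsQuaternionAlgebra`
(Vignéras I §1, Thm. 1.2.1). Stated as a theorem: `Algebra.IsCentral K ℍ[K,a,b]` and simplicity are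
not in Mathlib (`QuaternionAlgebra.finrank_eq_four` is). [cite: VignerasLNM800, Ch. I §1 Thm. 1.2.1] -/
def QuaternionAlgebra.isQuaternionAlgebra : Prop :=
  ∀ {K : Type*} [Field K] [NeZero (2 : K)] {a b : K} (ha : a ≠ 0) (hb : b ≠ 0),
    IsQuaternionAlgebra K ℍ[K,a,b]

/-! ### Reduced trace and norm -/

/-- The (non-reduced) algebra trace `Tr_{D/K}(x) = tr (y ↦ x y)` of a possibly non-commutative
finite-dimensional `K`-algebra `D`, as a `K`-linear map: Mathlib's `LinearMap.trace` composed with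
left multiplication `Algebra.lmul`. This is verbatim Mathlib's `Algebra.trace`, which however is
only declared for *commutative* `D` (`Mathlib/RingTheory/Trace/Defs.lean`); junk value `0` if `D`
is not finite-dimensional (Vignéras I §1). [folklore] -/
def leftMulTrace : D →ₗ[K] K := (LinearMap.trace K D).comp (Algebra.lmul K D).toLinearMap

/-- `leftMulTrace K D x` is the trace of left multiplication by `x` (definitional). [folklore] -/
@[simp]
theorem leftMulTrace_apply (x : D) :
    leftMulTrace K D x = LinearMap.trace K D (Algebra.lmul K D x) := rfl

/-- The **reduced trace** `trd : D →ₗ[K] K`, defined as `½ · Tr_{D/K}` (`leftMulTrace`).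
For a quaternion algebra over a field of characteristic `≠ 2` this is the classical reduced trace,
since `Tr_{D/K} = 2 trd` (Vignéras I §1); for other `D`, or in characteristic `2` (where
`2⁻¹ = 0`), it is a junk value. [folklore] -/
def reducedTrace : D →ₗ[K] K := (2 : K)⁻¹ • leftMulTrace K D

/-- The **standard involution** `x ↦ x̄ := trd(x) - x` of a quaternion algebra (Vignéras I §1:
`x̄ = trd(x) - x`). Junk unless `D` is a quaternion algebra in characteristic `≠ 2`. [folklore] -/
def standardInvolution (x : D) : D := algebraMap K D (reducedTrace K D x) - x

/-- The **reduced norm** `nrd(x) = x x̄`, extracted as the scalar `¼ · Tr_{D/K}(x x̄)` (for a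
quaternion algebra `x x̄ = nrd(x) · 1` and `Tr_{D/K}(1) = 4`; Vignéras I §1). Junk unless `D` is a
quaternion algebra in characteristic `≠ 2`. [folklore] -/
def reducedNorm (x : D) : K := (4 : K)⁻¹ * leftMulTrace K D (x * standardInvolution K D x)

/-- `x x̄ = nrd(x) · 1` in a quaternion algebra (Vignéras I §1, Lemme 1.1). [cite: VignerasLNM800, Ch. I §1 Lemme 1.1] -/
def mul_standardInvolution : Prop :=
  ∀ [CharZero K] [IsQuaternionAlgebra K D] (x : D),
    x * standardInvolution K D x = algebraMap K D (reducedNorm K D x)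

/-- The reduced norm is multiplicative (Vignéras I §1, Lemme 1.1). [cite: VignerasLNM800, Ch. I §1 Lemme 1.1] -/
def reducedNorm_mul : Prop :=
  ∀ [CharZero K] [IsQuaternionAlgebra K D] (x y : D),
    reducedNorm K D (x * y) = reducedNorm K D x * reducedNorm K D y

/-- `nrd(x)² = N_{D/K}(x)`: the algebra norm (Mathlib `Algebra.norm`, determinant of left
multiplication) of a quaternion algebra is the square of the reduced norm (Vignéras I §1,
Cor. 1.3). [cite: VignerasLNM800, Ch. I §1 Cor. 1.3] -/
def reducedNorm_sq_eq_norm : Prop :=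
  ∀ [CharZero K] [IsQuaternionAlgebra K D] (x : D),
    reducedNorm K D x ^ 2 = Algebra.norm K x

/-- `x ∈ D` is invertible iff `nrd(x) ≠ 0` (Vignéras I §1). [cite: VignerasLNM800, Ch. I §1] -/
def isUnit_iff_reducedNorm_ne_zero : Prop :=
  ∀ [CharZero K] [IsQuaternionAlgebra K D] (x : D),
    IsUnit x ↔ reducedNorm K D x ≠ 0

end IsQuaternionAlgebra

/-! ### Scalar extension with its module topology -/

section ScalarExtension

variable (K : Type*) [Field K] (R : Type*) [CommRing R] [Algebra K R]
  (D : Type*) [Ring D] [Algebra K D]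

/-- The scalar extension `D_R := R ⊗[K] D` of a `K`-algebra `D` to a commutative `K`-algebra `R`
(a type synonym of Mathlib's `R ⊗[K] D`, so that it can carry the `R`-module topology as an
instance without leaking it to all tensor products). Typical uses: `D ⊗_K 𝔸_K`, `D ⊗_K K_v`
(Vignéras III §1; FLT project `D ⊗[F] FiniteAdeleRing`). `K` is explicit because it cannot be
inferred from `R` and `D`. [folklore] -/
def ScalarExtension : Type _ := R ⊗[K] D

namespace ScalarExtension

/-- `R ⊗[K] D` is a ring (Mathlib `Algebra.TensorProduct.instRing`). [folklore] -/
instance instRing : Ring (ScalarExtension K R D) := inferInstanceAs (Ring (R ⊗[K] D))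

/-- `R ⊗[K] D` is an `R`-algebra via the left factor (Mathlib `Algebra.TensorProduct.leftAlgebra`);
Vignéras III §1. [folklore] -/
instance instAlgebra : Algebra R (ScalarExtension K R D) := inferInstanceAs (Algebra R (R ⊗[K] D))

/-- `R ⊗[K] D` is a `K`-algebra (Mathlib instance on the tensor product). [folklore] -/
instance instAlgebraBase : Algebra K (ScalarExtension K R D) :=
  inferInstanceAs (Algebra K (R ⊗[K] D))

/-- Compatibility of the `K`- and `R`-algebra structures on `R ⊗[K] D`
(Mathlib `Algebra.TensorProduct.isScalarTower_left`-type instance). [folklore] -/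
instance instIsScalarTower : IsScalarTower K R (ScalarExtension K R D) :=
  inferInstanceAs (IsScalarTower K R (R ⊗[K] D))

/-- If `D` is finite-dimensional over `K` then `R ⊗[K] D` is a finite `R`-module
(Mathlib `Module.Finite.base_change`). [folklore] -/
instance instModuleFinite [Module.Finite K D] : Module.Finite R (ScalarExtension K R D) :=
  inferInstanceAs (Module.Finite R (R ⊗[K] D))

/-- The identification `R ⊗[K] D ≃ₐ[R] ScalarExtension K R D` (the identity). [folklore] -/
def ofTensor : R ⊗[K] D ≃ₐ[R] ScalarExtension K R D := AlgEquiv.refl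

/-- The inclusion `D →ₐ[K] R ⊗[K] D`, `x ↦ 1 ⊗ x` (Mathlib `Algebra.TensorProduct.includeRight`);
the diagonal embedding `D ↪ D_R` (Vignéras III §1). [folklore] -/
def incl : D →ₐ[K] ScalarExtension K R D :=
  (Algebra.TensorProduct.includeRight : D →ₐ[K] R ⊗[K] D)

/-- `incl x = 1 ⊗ₜ x` (definitional). [folklore] -/
theorem incl_apply (x : D) : incl K R D x = ofTensor K R D ((1 : R) ⊗ₜ[K] x) := rfl

variable {R} in
/-- Functoriality of scalar extension in the ring of scalars: a `K`-algebra map `R →ₐ[K] S`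
induces `R ⊗[K] D →ₐ[K] S ⊗[K] D` (Mathlib `Algebra.TensorProduct.map`). Used for the
projections `D_𝔸 → D_v`. [folklore] -/
def mapLeft {S : Type*} [CommRing S] [Algebra K S] (f : R →ₐ[K] S) :
    ScalarExtension K R D →ₐ[K] ScalarExtension K S D :=
  (Algebra.TensorProduct.map f (AlgHom.id K D) : R ⊗[K] D →ₐ[K] S ⊗[K] D)

/-- `mapLeft f (r ⊗ x) = f r ⊗ x` (Mathlib `Algebra.TensorProduct.map_tmul`). [folklore] -/
@[simp]
theorem mapLeft_tmul {S : Type*} [CommRing S] [Algebra K S] (f : R →ₐ[K] S) (r : R) (x : D) :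
    mapLeft K D f (ofTensor K R D (r ⊗ₜ[K] x)) = ofTensor K S D (f r ⊗ₜ[K] x) :=
  Algebra.TensorProduct.map_tmul _ _ _ _

/-- `mapLeft f` intertwines the structure maps: `mapLeft f (algebraMap R _ r) = algebraMap S _ (f r)`
(so `mapLeft f` is `f`-semilinear). [folklore] -/
theorem mapLeft_algebraMap {S : Type*} [CommRing S] [Algebra K S] (f : R →ₐ[K] S) (r : R) :
    mapLeft K D f (algebraMap R (ScalarExtension K R D) r) =
      algebraMap S (ScalarExtension K S D) (f r) :=
  Algebra.TensorProduct.map_tmul _ _ _ _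

variable [TopologicalSpace R]

/-- The `R`-module topology on `R ⊗[K] D` (Mathlib `moduleTopology`): the finest topology making
it a topological `R`-module; for `D` finite free over `K` it is the product topology on
`R^{dim D}` (Vignéras III §1; FLT project). [folklore] -/
instance instTopologicalSpace : TopologicalSpace (ScalarExtension K R D) :=
  moduleTopology R (ScalarExtension K R D)

/-- `ScalarExtension K R D` carries the `R`-module topology, by definition. [folklore] -/
instance instIsModuleTopology : IsModuleTopology R (ScalarExtension K R D) := ⟨rfl⟩

/-- Addition on `R ⊗[K] D` is continuous for the module topology
(Mathlib `IsModuleTopology.toContinuousAdd`). [folklore] -/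
instance instContinuousAdd : ContinuousAdd (ScalarExtension K R D) :=
  IsModuleTopology.toContinuousAdd R _

/-- Scalar multiplication `R × (R ⊗[K] D) → R ⊗[K] D` is continuous for the module topology
(Mathlib `IsModuleTopology.toContinuousSMul`). [folklore] -/
instance instContinuousSMul : ContinuousSMul R (ScalarExtension K R D) :=
  IsModuleTopology.toContinuousSMul R _

/-- For `R` a topological ring and `D` finite-dimensional, `R ⊗[K] D` with the module topology is
a topological ring (Mathlib `IsModuleTopology.isTopologicalRing`); hence `(R ⊗[K] D)ˣ` is a
topological group (Mathlib `Units` instances). [folklore] -/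
instance instIsTopologicalRing [IsTopologicalRing R] [Module.Finite K D] :
    IsTopologicalRing (ScalarExtension K R D) :=
  IsModuleTopology.isTopologicalRing R _

example [IsTopologicalRing R] [Module.Finite K D] : IsTopologicalGroup (ScalarExtension K R D)ˣ :=
  inferInstance

/-- Continuity of `mapLeft f : R ⊗[K] D → S ⊗[K] D` for a *continuous* `K`-algebra map `f : R → S`
between topological rings, module topologies on both sides (honest proof: Mathlib
`IsModuleTopology.continuous_of_ringHom`, the composite `R → R ⊗ D → S ⊗ D` being
`algebraMap S _ ∘ f`). [folklore] -/
theorem continuous_mapLeft [Module.Finite K D] {S : Type*} [CommRing S] [Algebra K S]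
    [TopologicalSpace S] [IsTopologicalRing S] (f : R →ₐ[K] S) (hf : Continuous f) :
    Continuous (mapLeft K D f) := by
  refine IsModuleTopology.continuous_of_ringHom (R := R) (mapLeft K D f).toRingHom ?_
  have : ((mapLeft K D f).toRingHom.comp (algebraMap R (ScalarExtension K R D)) : R → _) =
      algebraMap S (ScalarExtension K S D) ∘ f := by
    ext r
    exact mapLeft_algebraMap K R D f r
  rw [this]
  exact (continuous_algebraMap S (ScalarExtension K S D)).comp hf

end ScalarExtension

end ScalarExtension

/-! ### Adelic and local unit groups of `D` -/

section NumberField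

variable (K : Type) [Field K] [NumberField K] (D : Type u) [Ring D] [Algebra K D]

/-- The **adelic unit group** `D_𝔸ˣ = (D ⊗_K 𝔸_K)ˣ` of a `K`-algebra `D`, a topological group for
the module topology when `D` is finite-dimensional (Vignéras III §1; Weil, BNT Ch. IX). [folklore] -/
abbrev adelicUnits : Type u := (ScalarExtension K (AdeleRing (𝓞 K) K) D)ˣ

/-- The **finite-adelic unit group** `(D ⊗_K 𝔸_K^∞)ˣ` (FLT project's `Dfx`; Vignéras III §1). [folklore] -/
abbrev finiteAdelicUnits : Type u := (ScalarExtension K (FiniteAdeleRing (𝓞 K) K) D)ˣ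

variable {K} in
/-- The **local unit group** `D_vˣ = (D ⊗_K K_v)ˣ` at a finite place `v` (Vignéras II §1). [folklore] -/
abbrev completionUnits (v : HeightOneSpectrum (𝓞 K)) : Type u :=
  (ScalarExtension K (v.adicCompletion K) D)ˣ

/-- The diagonal embedding `Dˣ →* (D ⊗_K 𝔸_K)ˣ`, `x ↦ 1 ⊗ x` (`Units.map` of
`Algebra.TensorProduct.includeRight`; Vignéras III §1). [folklore] -/
def inclAdelic : Dˣ →* adelicUnits K D :=
  Units.map (ScalarExtension.incl K (AdeleRing (𝓞 K) K) D).toRingHom.toMonoidHom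

/-- The diagonal embedding `Dˣ →* (D ⊗_K 𝔸_K^∞)ˣ` (FLT project; Vignéras III §1). [folklore] -/
def inclFinite : Dˣ →* finiteAdelicUnits K D :=
  Units.map (ScalarExtension.incl K (FiniteAdeleRing (𝓞 K) K) D).toRingHom.toMonoidHom

/-- The projection `𝔸_K →ₐ[K] K_v` at a finite place, as a `K`-algebra map (upgrading
`AdelicGroupData.adeleEval`; the compatibility with `algebraMap` is Mathlib
`algebraMap_adicCompletion`). [folklore] -/
def adeleEvalAlgHom (v : HeightOneSpectrum (𝓞 K)) :
    AdeleRing (𝓞 K) K →ₐ[K] v.adicCompletion K where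
  __ := AdelicGroupData.adeleEval K v
  commutes' _ := rfl

/-- `adeleEvalAlgHom K v x = x.2 v` (definitional). [folklore] -/
@[simp]
theorem adeleEvalAlgHom_apply (v : HeightOneSpectrum (𝓞 K)) (x : AdeleRing (𝓞 K) K) :
    adeleEvalAlgHom K v x = x.2 v := rfl

/-- The projection `𝔸_K →ₐ[K] K_v` is continuous (`AdelicGroupData.continuous_adeleEval`). [folklore] -/
theorem continuous_adeleEvalAlgHom (v : HeightOneSpectrum (𝓞 K)) :
    Continuous (adeleEvalAlgHom K v) :=
  AdelicGroupData.continuous_adeleEval K v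

/-- The projection `(D ⊗ 𝔸_K)ˣ →* (D ⊗ K_v)ˣ` onto the component at a finite place `v`
(`Units.map` of `ScalarExtension.mapLeft (adeleEvalAlgHom K v)`; Vignéras III §1). [folklore] -/
def toCompletionUnits (v : HeightOneSpectrum (𝓞 K)) : adelicUnits K D →* completionUnits D v :=
  Units.map (ScalarExtension.mapLeft K D (adeleEvalAlgHom K v)).toRingHom.toMonoidHom

/-- The projection `(D ⊗ 𝔸_K)ˣ → (D ⊗ K_v)ˣ` is continuous (honest proof: linear maps out of a
module topology are continuous, and `𝔸_K ⊗ D → K_v ⊗ D` factors through the continuous ring map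
`𝔸_K → K_v`; see `ScalarExtension.continuous_mapLeft`). [folklore] -/
theorem continuous_toCompletionUnits [Module.Finite K D] (v : HeightOneSpectrum (𝓞 K)) :
    Continuous (toCompletionUnits K D v) :=
  Units.continuous_map
    (ScalarExtension.continuous_mapLeft K _ D (adeleEvalAlgHom K v)
      (continuous_adeleEvalAlgHom K v))

/-! ### Ramification -/

variable {K} in
/-- `D` is **split** at the finite place `v`: `D ⊗_K K_v ≃ M₂(K_v)` as `K_v`-algebras
(Vignéras II §1, III §3). [folklore] -/
def IsSplitAt (v : HeightOneSpectrum (𝓞 K)) : Prop :=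
  Nonempty (ScalarExtension K (v.adicCompletion K) D ≃ₐ[v.adicCompletion K]
    Matrix (Fin 2) (Fin 2) (v.adicCompletion K))

variable {K} in
/-- `D` is **split** at the infinite place `w`: `D ⊗_K K_w ≃ M₂(K_w)` as `K_w`-algebras
(`K_w = w.Completion`, Mathlib `NumberField.InfinitePlace.Completion`; Vignéras III §3). [folklore] -/
def IsSplitAtInfinite (w : InfinitePlace K) : Prop :=
  Nonempty (ScalarExtension K w.Completion D ≃ₐ[w.Completion] Matrix (Fin 2) (Fin 2) w.Completion)

/-- The set `Ram_f(D)` of finite places where `D` is ramified (not split) (Vignéras III §3). [folklore] -/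
def ramifiedPlaces : Set (HeightOneSpectrum (𝓞 K)) := {v | ¬ IsSplitAt D v}

/-- The set `Ram_∞(D)` of infinite places where `D` is ramified (Vignéras III §3). [folklore] -/
def ramifiedInfinitePlaces : Set (InfinitePlace K) := {w | ¬ IsSplitAtInfinite D w}

/-- `D` is **totally definite**: ramified at every infinite place (so `K` is totally real and
`D ⊗_K K_w` is Hamilton's quaternions for all `w`; Vignéras III §3, and Ch. V, introduction:
"ramifiée sur toutes les places archimédiennes"). This is a *predicate* on the `K`-algebra `D`
— hence the explicit binder `(D …)`, which re-binds the section variable with the same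
signature — and not a statement expected to hold for every `D`: it fails for the split
quaternion algebra `M₂(K)` (`not_isTotallyDefinite_matrix`,
`Literature/NumberTheory/Automorphic/QuaternionAlgebraAdelicMatrixProofs.lean`) and is the
standing hypothesis of Vignéras Ch. V. [folklore] -/
def IsTotallyDefinite (D : Type u) [Ring D] [Algebra K D] : Prop :=
  ∀ w : InfinitePlace K, ¬ IsSplitAtInfinite D w

variable {D} in
/-- `v ∈ ramifiedPlaces K D ↔ ¬ IsSplitAt D v` (definitional). [folklore] -/
@[simp]
theorem mem_ramifiedPlaces_iff (v : HeightOneSpectrum (𝓞 K)) :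
    v ∈ ramifiedPlaces K D ↔ ¬ IsSplitAt D v := Iff.rfl

variable {D} in
omit [NumberField K] in
/-- `w ∈ ramifiedInfinitePlaces K D ↔ ¬ IsSplitAtInfinite D w` (definitional). [folklore] -/
@[simp]
theorem mem_ramifiedInfinitePlaces_iff (w : InfinitePlace K) :
    w ∈ ramifiedInfinitePlaces K D ↔ ¬ IsSplitAtInfinite D w := Iff.rfl

/-- A quaternion algebra over a number field is split at all but finitely many places
(Vignéras III §3, Lemme 3.1). [cite: VignerasLNM800, Ch. III §3 Lemme 3.1] -/
def ramifiedPlaces_finite : Prop :=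
  ∀ [IsQuaternionAlgebra K D],
    (ramifiedPlaces K D).Finite

/-- **Parity of ramification**: the number of ramified places (finite and infinite) of a
quaternion algebra over a number field is even (Vignéras III §3, Thm. 3.1, from the reciprocity
law for the Hilbert symbol). Stated with `Set.ncard` (`ramifiedPlaces` is finite by
`ramifiedPlaces_finite`, and there are finitely many infinite places). [cite: VignerasLNM800, Ch. III §3 Thm. 3.1] -/
def even_card_ramified : Prop :=
  ∀ [IsQuaternionAlgebra K D],
    Even ((ramifiedPlaces K D).ncard + (ramifiedInfinitePlaces K D).ncard)

variable {K} in
/-- A quaternion algebra is split at every complex place (`M₂(ℂ)` is the only central simple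
`ℂ`-algebra of dimension `4`; Vignéras III §3). [cite: VignerasLNM800, Ch. III §3] -/
def isSplitAtInfinite_of_isComplex : Prop :=
  ∀ [IsQuaternionAlgebra K D] (w : InfinitePlace K) (hw : w.IsComplex),
    IsSplitAtInfinite D w

/-- The base field of a totally definite quaternion algebra is totally real
(Vignéras III §3). [cite: VignerasLNM800, Ch. III §3] -/
def isTotallyReal_of_isTotallyDefinite : Prop :=
  ∀ [IsQuaternionAlgebra K D] (h : IsTotallyDefinite K D),
    IsTotallyReal K

/-- **Classification** (existence half): for every finite set `S` of finite places and every set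
`T` of real places with `|S| + |T|` even there is a quaternion algebra over `K` ramified exactly
at `S ∪ T` (Vignéras III §3, Thm. 3.1; Hasse–Brauer–Noether). [cite: VignerasLNM800, Ch. III §3 Thm. 3.1] -/
def exists_isQuaternionAlgebra_of_even : Prop :=
  ∀ (S : Finset (HeightOneSpectrum (𝓞 K))) (T : Finset (InfinitePlace K)) (hT : ∀ w ∈ T, w.IsReal) (hST : Even (S.card + T.card)),
    ∃ (D' : Type) (_ : Ring D') (_ : Algebra K D'), IsQuaternionAlgebra K D' ∧
      ramifiedPlaces K D' = ↑S ∧ ramifiedInfinitePlaces K D' = ↑T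

/-- **Classification** (uniqueness half): quaternion algebras over a number field with the same
ramification sets are isomorphic (Vignéras III §3, Thm. 3.1). [cite: VignerasLNM800, Ch. III §3 Thm. 3.1] -/
def nonempty_algEquiv_of_ramifiedPlaces_eq : Prop :=
  ∀ (D' : Type*) [Ring D'] [Algebra K D'] [IsQuaternionAlgebra K D] [IsQuaternionAlgebra K D'] (hf : ramifiedPlaces K D = ramifiedPlaces K D') (hi : ramifiedInfinitePlaces K D = ramifiedInfinitePlaces K D'),
    Nonempty (D ≃ₐ[K] D')

/-- For a quaternion algebra `D` and a non-trivial commutative `K`-algebra `R`, an element of `D`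
becomes a unit in `R ⊗_K D` iff it is a unit in `D` (`nrd` detects units and is compatible with
scalar extension; Vignéras I §1, III §1). [cite: VignerasLNM800, Ch. I §1 and Ch. III §1] -/
def isUnit_scalarExtension_iff : Prop :=
  ∀ [CharZero K] [IsQuaternionAlgebra K D] (R : Type*) [CommRing R] [Algebra K R] [Nontrivial R] (x : D),
    IsUnit (ScalarExtension.incl K R D x) ↔ IsUnit x

/-! ### The global datum of `D^×` (outline D10, review F10) -/

/-- The central embedding `ℝ_{>0} →* (D ⊗ 𝔸_K)ˣ`, `t ↦ (t)_{v ∣ ∞} ⊗ 1`: `posRealIdele K`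
followed by `algebraMap 𝔸_K (𝔸_K ⊗ D)`. Its image is the split component `A_G` for `G = D^×`
(outline D10; Borel 1963 §5). [cite: Borel1963, §5] -/
def posRealCentral : ℝ≥0ˣ →* adelicUnits K D :=
  (Units.map (algebraMap (AdeleRing (𝓞 K) K)
      (ScalarExtension K (AdeleRing (𝓞 K) K) D)).toMonoidHom).comp (posRealIdele K)

/-- `posRealCentral K D t` is central in `(D ⊗ 𝔸_K)ˣ` (honest proof by `Algebra.commutes`;
outline D10). [folklore] -/
theorem posRealCentral_mem_center (t : ℝ≥0ˣ) :
    posRealCentral K D t ∈ Subgroup.center (adelicUnits K D) := by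
  rw [Subgroup.mem_center_iff]
  intro g
  ext1
  simp only [posRealCentral, MonoidHom.coe_comp, Function.comp_apply, Units.val_mul,
    Units.coe_map, RingHom.toMonoidHom_eq_coe, MonoidHom.coe_coe]
  exact (Algebra.commutes _ _).symm

/-- The **adelic group datum of `D^×`** for a finite-dimensional `K`-algebra `D` (typically a
quaternion algebra): `Rational := Dˣ`, `Adelic := (D ⊗ 𝔸_K)ˣ`, `Local v := (D ⊗ K_v)ˣ`,
`toLocal v` induced by `𝔸_K → K_v` (continuity proved), and `center' := A_G = ℝ_{>0}`
(`posRealCentral`, outline D10). (Vignéras III §1–2; Borel 1963 §5.) [cite: Borel1963, §5] -/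
def AdelicGroupData.units [Module.Finite K D] : AdelicGroupData.{u} K where
  Rational := Dˣ
  Adelic := adelicUnits K D
  toAdelic := inclAdelic K D
  Local v := completionUnits D v
  toLocal v := toCompletionUnits K D v
  continuous_toLocal v := continuous_toCompletionUnits K D v
  center' := (posRealCentral K D).range
  center'_le := by
    rintro _ ⟨t, rfl⟩
    exact posRealCentral_mem_center K D t

/-- `(AdelicGroupData.units K D).Adelic = (D ⊗ 𝔸_K)ˣ` (definitional). [folklore] -/
@[simp]
theorem AdelicGroupData.units_Adelic [Module.Finite K D] :
    (AdelicGroupData.units K D).Adelic = adelicUnits K D := rfl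

/-- `(AdelicGroupData.units K D).Rational = Dˣ` (definitional). [folklore] -/
@[simp]
theorem AdelicGroupData.units_Rational [Module.Finite K D] :
    (AdelicGroupData.units K D).Rational = Dˣ := rfl

/-- `(AdelicGroupData.units K D).center' = ℝ_{>0}` embedded by `posRealCentral` (definitional;
outline D10). [folklore] -/
@[simp]
theorem AdelicGroupData.units_center' [Module.Finite K D] :
    (AdelicGroupData.units K D).center' = (posRealCentral K D).range := rfl

/-- `Dˣ` is discrete in `(D ⊗ 𝔸_K)ˣ` for `D` finite-dimensional over `K` (discreteness of `K` in
`𝔸_K`; Weil, BNT IV §2, Vignéras III §1). [cite: WeilBNT1967, Ch. IV §2] -/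
def AdelicGroupData.units_isDiscreteRational : Prop :=
  ∀ [Module.Finite K D],
    (AdelicGroupData.units K D).IsDiscreteRational

/-- **Fujisaki's lemma**: for a *division* quaternion algebra `D` over a number field the
automorphic quotient `(D ⊗ 𝔸_K)ˣ ⧸ (ℝ_{>0} · Dˣ)` is compact (Vignéras III §1, Thm. 1.4 and
III §2; Weil, BNT IV §4). The division hypothesis is essential (`M₂(K)` gives a non-compact
quotient). [cite: VignerasLNM800, Ch. III §1 Thm. 1.4 and §2 (Fujisaki)] -/
def AdelicGroupData.compactSpace_automorphicQuotient_units : Prop :=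
  ∀ [IsQuaternionAlgebra K D] (hdiv : ∀ x : D, x ≠ 0 → IsUnit x),
    CompactSpace (AdelicGroupData.units K D).automorphicQuotient

/-- The automorphic quotient of `D^×` for a quaternion algebra `D` carries an automorphic measure
(finite invariant Radon measure of full support; Borel 1963 Thm. 5.8, Vignéras III §2). [cite: Borel1963, Thm. 5.8  Vignéras III §2] -/
def AdelicGroupData.exists_isAutomorphicMeasure_units : Prop :=
  ∀ [IsQuaternionAlgebra K D],
    ∃ μ : Measure (AdelicGroupData.units K D).automorphicQuotient,
      (AdelicGroupData.units K D).IsAutomorphicMeasure μ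

end NumberField

end Literature.NumberTheory.Automorphic
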